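import Summits.BirchSwinnertonDyer.Rank1Residual.Additive.XGordRankZeroCyclotomicThreeLower
import Summits.BirchSwinnertonDyer.Rank1Residual.Additive.X4RankZeroCyclotomicThree
import Summits.BirchSwinnertonDyer.Rank1Residual.Additive.GordRankZeroChiBranch
import Summits.BirchSwinnertonDyer.Rank1Residual.Additive.TypeGThree
import Summits.BirchSwinnertonDyer.Rank1Residual.Partition.HeadlineNoLemma20
import HarnessLib

/-!
# The LOWER twin of line V14b (X4, `p = 3`, over `K = ℚ(ζ₃)`) from named facts + the ONE residual
# input (⊇/K); consequences: `Typed.MissingLowerBoundAt W 3` and `BSD(W,3)` on the (G-ord, `e = 2`)@3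
# rows with `surj(3) ∧ ram(3)`, ranks `(0,0)` — ANOMALOUS ROWS INCLUDED — and the Λ-adic twist
# transport `BSD(W,3) ↔ BSD(V,3)` (cell `b2b-bsdres`, team n1011, seat p16, OWNERS row T-N11-GK3LOW)

HONEST FRAMING (cell `b2b-bsdres`, run/shared/lean/b2b/bsd-rank1-residual/, verbatim in every
file): the goal of the cell is to DELETE the COMBINATION-SHAPED residual classes of the
Birch–Swinnerton-Dyer formula for ALL analytic-rank `≤ 1` elliptic curves over `ℚ` — "full BSD
formula for every rank `≤ 1` curve in class `C`" assembled STRICTLY from published theorems — so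
that the rank-`≤ 1` remainder becomes exactly the CONSTRUCTION-SHAPED classes, which are TYPED
(missing-input `Prop`s), NOT attempted. This is not "finishing BSD". Team n1011 (N10 / N11), seat
p16: research route; the labels of X4 / X10 and the N10 / N11 marks are UNCHANGED by this file;
nothing is booked here (the referee rules on bookings).

Theorems only (no `def`, no `sorry`, no new named fact). Companion of
`XGordRankZeroCyclotomicThreeLower.lean` (core theorem, class-agnostic; mathematics in its module
docstring). Here `K` is instantiated as `CyclotomicField 3 ℚ`, and — exactly as additive-p4 did for the
UPPER line V14b in `X4RankZeroCyclotomicThree.lean` — the inline hypotheses of the core theorem are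
discharged from NAMED FACTS: `hTorK` (torsion of `X(V/K_∞)`) from Kato 2004 Thm. 17.4 (3) over `K`
(`Kato2004.charIdeal_dvd_padicLFunction_cyclotomicThree_of_surjective`, its (A)-clause; the image
hypothesis `ρ̄_{V,3^n}` onto for all `n` is the census pair `surj(3) ∧ ram(3)` of the ADDITIVE curve `W`
by `forall_surj_pow_of_twist_pStar_of_surj_of_ram`), `hGrK` from Greenberg LNM 1716 Thm. 4.1 over number
fields (`Greenberg1999.thm41_charValue_rankZero_numberField`, K-shape
`X3CyclotomicThree.greenbergK_of_fact`), `hexK` / `hD1` from tree theorems, the newform and period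
ratios from a modular-parametrisation datum (`hmodD`). What is NOT discharged — and is carried by every
theorem below as the explicit hypothesis `hLowK` — is the ONE residual input

  (⊇/K)  for the cyclotomic `ℤ₃`-extension of `K = ℚ(ζ₃) = ℚ(√−3)` and every Pontryagin-dual datum
         `D` of `Sel_{3^∞}(V_K/K_∞)`: every `g ∈ char_Λ X(V/K_∞)` is `ι h · ϖϖ' · L₃(V,ω⁰,T) · L₃(V,ω¹,T)`
         for some `h ∈ Λ = ℤ₃⟦T⟧` (for every newform / period normalisation `(f, ϖ, ϖ')` of `V`),

i.e. the main-conjecture CONTAINMENT for `V` over `ℚ(√−3)` — the wall named in the team's PLAN §1.2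
II.3 ("IMC-⊇ over `ℚ(√p*)` with `p ∣ D_K`") at `p = 3`, written as the binder list of the Kato fact
with its divisibility REVERSED. It is NOT in print (Skinner–Urban 2014 Thm. 3.6.4: branch `ω⁰` over `ℚ`
only, under `(irr)`, `(ram)`, `p ∤ N`); no `def` and no named fact is made of it here.

## Results (`V` good ordinary at `3`, `W = C • V^{(−3)}` additive at `3`, ranks `(0,0)`)

* `XGordCyclotomicThreeLower.exists_padicVal_shaAn_add_le_of_facts` / `…_of_surj_of_ram` —
  **`ord₃ #Ш_an(V) + ord₃ #Ш_an(W) ≤ ord₃ #Ш(V) + ord₃ #Ш(W)`** from (⊇/K) + named facts;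
* `XGordCyclotomicThreeLower.padicVal_shaOrder_add_eq_of_surj_of_ram` — with line V14b (Kato ⊆ over `K`):
  **EQUALITY** of the two sums under the two-sided main conjecture over `K`;
* `XGordCyclotomicThreeLower.missingLowerBoundAt_of_missingUpperBoundAt_twist_of_surj_of_ram` —
  `Typed.MissingLowerBoundAt W 3` ⟸ (⊇/K) + the UPPER half of the TWIST `V` (and the symmetric
  `missingLowerBoundAt_twist_of_missingUpperBoundAt_of_surj_of_ram` for the good ordinary curve `V`);
* `XGordCyclotomicThreeLower.bsdp_iff_bsdp_twist_of_surj_of_ram` — **`BSD(W,3) ↔ BSD(V,3)`**: under the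
  two-sided main conjecture over `K` the `3`-part of BSD is INVARIANT under the ramified twist
  `V ↦ V^{(−3)}` (a Λ-adic twin of seat p08's finite-level `TwistComparison.DefectAgreeAt`);
* `XGordCyclotomicThreeLower.bsdp_of_surj_of_ram` — **`BSD(W,3)`** ⟸ (⊇/K) + named facts, using for
  `BSD(V,3)` the tree theorem `bsdp_three_of_goodOrd_of_surj_noL20` (every `E/ℚ` of analytic rank `≤ 1`,
  good ordinary at `3`, `ρ̄₃` onto ⇒ `BSD(E,3)`: Yan–Zhu 2026 Thm. 4.15 [PUB\*, flag
  `YZ26@3-BF-ERL-Ohta`] + modularity + GZK; seat p02);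
* class forms on N11's (G-ord)@3 rows: `ClassX4Gord.missingLowerBoundAt_three_rankZero_of_lowerK_of_surj_of_ram`,
  `ClassX4Gord.bsdp_three_rankZero_of_lowerK_of_surj_of_ram`, `ClassX4Gord.bsdp_three_iff_twist_of_lowerK_of_surj_of_ram`
  (the good-ordinary twist model from `ClassX4Gord.exists_goodOrd_pStar_twist_model`, defect `e = 2`
  automatic at `3` by `semistabilityIndex_eq_two_of_typeG_three`).

WHY (OWNERS row T-N11-GK3LOW): the cell's other LOWER chains on these rows pass through Delbourgo 2002
Thm. (B) for the additive `W` and so carry, on the ANOMALOUS rows (`a₃(V) ≡ 1 (mod 3)`), a slack `≤ 2`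
or the second typed input `ExactLeadingTermAt W 3`; the `K`-route has neither. Price: (⊇/K) contains
the trivial branch as well as the `χ_K`-branch, and `r_an(V) = 0` (ranks `(0,1)`: line V17's twin, not
here). Census of the rows: the cell's census seats (p06 Q6 register: 7 of 17 Gord3 rows anomalous).
-/

noncomputable section

open scoped Classical MatrixGroups ModularForm

open CongruenceSubgroup WeierstrassCurve NumberField IsDedekindDomain
  Literature.NumberTheory.EllipticCurves Literature.NumberTheory.EllipticCurves.ModularForms
  Literature.NumberTheory.EllipticCurves.Rank1Residual
  Literature.NumberTheory.EllipticCurves.Rank1Residual.Typed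
  Literature.NumberTheory.GaloisRepresentations

namespace Summit.BirchSwinnertonDyer.Rank1Residual.Additive

section Facts

variable (V : WeierstrassCurve ℚ) [V.IsElliptic] [V.IsGloballyMinimal]
  (W : WeierstrassCurve ℚ) [W.IsElliptic] [W.IsGloballyMinimal]

/- The ONE residual input (⊇/K) for `V` over `K = CyclotomicField 3 ℚ` — the binder list of
`Kato2004.charIdeal_dvd_padicLFunction_cyclotomicThree_of_surjective` for this `V` and `V' = V_K` with the
divisibility REVERSED; a section hypothesis shared by every theorem of this section (module docstring). -/
variable
    (hLowK : ∀ {κ : ZpExtension (CyclotomicField 3 ℚ) 3}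
      {γ : Field.absoluteGaloisGroup (CyclotomicField 3 ℚ)} {N : ℕ} [NeZero N]
      {f : CuspForm (Gamma0 N) 2},
      κ.IsCyclotomic → κ.IsTopGenerator γ →
      (∃ ζ : ℤ_[3]ˣ, IsOfFinOrder ζ ∧
        ((GaloisRep.cyclotomicCharacter (CyclotomicField 3 ℚ) 3 γ * ζ : ℤ_[3]ˣ) : ℤ_[3]) =
          (cyclotomicGenerator 3 : ℤ_[3])) →
      IsNewformOf V f →
      ∀ (D : (V.baseChange (CyclotomicField 3 ℚ)).SelmerDualData κ γ) (ϖ ϖ' : ℚ),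
        (ϖ : ℝ) * V.realPeriodRat = plusPeriod f →
        (ϖ' : ℝ) * V.imaginaryPeriodRat = minusPeriod f →
        ∀ g ∈ D.charIdeal, ∃ h : IwasawaAlgebra 3,
          iwasawaToPowerSeries 3 g =
            iwasawaToPowerSeries 3 h *
              (PowerSeries.C ((ϖ : ℚ_[3]) * (ϖ' : ℚ_[3])) *
                (padicLFunction f ((unitRoot V 3 : ℤ_[3]) : ℚ_[3]) *
                  padicLFunctionMinusBranch f ((unitRoot V 3 : ℤ_[3]) : ℚ_[3]) 1)))

include hLowK

/-- **LOWER twin of line V14b, from named facts + (⊇/K).** For `V/ℚ` globally minimal, good ordinary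
at `3` with `ρ̄_{V,3^n}` surjective for every `n`, `W = C • V^{(−3)}` globally minimal ADDITIVE at `3`
(X4 ∧ (G-ord, `e = 2`) at `p = 3`), both of analytic rank `0`: `#Ш_an(V) = q_V`, `#Ш_an(W) = q_W` with
**`ord₃ q_V + ord₃ q_W ≤ ord₃ #Ш(V) + ord₃ #Ш(W)`**, from (⊇/K) (`hLowK`, the residual input — module
docstring), Kato Thm. 17.4 (3) over `K` (`hKato`, named fact: TORSION clause only), Greenberg Thm. 4.1
over number fields (`hGr`, named fact), Milne (`hMilne`, named fact), modularity (`hmod`, `hmodD`), GZK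
(`hGZK`); the cyclotomic setting and the odd-branch constant term are tree theorems.
[cite: GreenbergLNM1716, Thm. 4.1 (p. 102)] [cite: Kato2004Asterisque, Thm. 17.4 (p. 273)]
[cite: Milne1972ArithmeticAV, §1 Thm. 1] -/
theorem XGordCyclotomicThreeLower.exists_padicVal_shaAn_add_le_of_facts
    (hKato : Kato2004.charIdeal_dvd_padicLFunction_cyclotomicThree_of_surjective)
    (hGr : Greenberg1999.thm41_charValue_rankZero_numberField)
    (hMilne : Milne1972.bsdQuotient_baseChange_quadratic_anyModel)
    (hGZK : rank_eq_analyticRank_of_analyticRank_le_one) (hmod : hasEntireLFunction_rat)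
    (hmodD : nonempty_modularParametrizationData)
    (C : VariableChange ℚ) (hC : C • V.quadraticTwist (-(3 : ℚ)) = W)
    (hord : IsOrdinaryAt V 3) (hsurj : ∀ n : ℕ, V.HasSurjectiveModNGaloisRep (3 ^ n : ℕ))
    (hadd : Addv W 3) (hrV : V.analyticRank = 0) (hrW : W.analyticRank = 0) :
    ∃ qV qW : ℚ, shaAn V = (qV : ℂ) ∧ shaAn W = (qW : ℂ) ∧
      padicValRat 3 qV + padicValRat 3 qW ≤ (padicValNat 3 V.shaOrder : ℤ) + padicValNat 3 W.shaOrder := by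
  haveI : IsCyclotomicExtension {3} ℚ (CyclotomicField 3 ℚ) := CyclotomicField.isCyclotomicExtension 3 ℚ
  -- the newform and the two rational period ratios
  haveI : NeZero (V.conductorNorm ℤ) := ⟨(V.conductorNorm_pos_holds).ne'⟩
  obtain ⟨Dm⟩ := hmodD V
  have hf : IsNewformOf V Dm.f := Dm.isNewformOf
  obtain ⟨ϖ, -, hϖ, -⟩ := Dm.exists_rat_mul_realPeriodRat_eq_plusPeriod
  obtain ⟨ϖ', -, hϖ'⟩ := exists_rat_mul_imaginaryPeriodRat_eq_minusPeriod Dm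
  haveI : (V.baseChange (CyclotomicField 3 ℚ)).IsElliptic := by rw [baseChange]; infer_instance
  refine XGordCyclotomicThreeLower.exists_padicVal_shaAn_add_le (CyclotomicField 3 ℚ) V W hGZK hmod
    hMilne C hC hord hadd hrV hrW hf ϖ ϖ' hϖ hϖ'
    (exists_isCyclotomic_isTopGenerator_cyclotomicThree (CyclotomicField 3 ℚ))
    (fun κ γ hκ hγ hγ' D ↦ ?_) (fun κ γ hκ hγ hγ' D g hg ↦ ?_)
    (X3CyclotomicThree.greenbergK_of_fact (CyclotomicField 3 ℚ) V hGr hord)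
    (constantCoeff_padicLFunctionMinusBranch_one_three V hord hf)
  · exact (hKato V (CyclotomicField 3 ℚ) (V.baseChange (CyclotomicField 3 ℚ)) hord hsurj
      ⟨1, one_smul _ _⟩ hκ hγ hγ' hf D ϖ ϖ' hϖ hϖ').1
  · exact hLowK hκ hγ hγ' hf D ϖ ϖ' hϖ hϖ' g hg

/-- **The same with the image hypothesis as CENSUS BITS of `W`**: `surj(3)` (`ρ̄_{W,3}` onto) and
`ram(3)` (a multiplicative prime `ℓ ≠ 3` of `W` with `3 ∤ v_ℓ(Δ_min)`) give `ρ̄_{V,3^n}` onto for every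
`n` for the twist (`forall_surj_pow_of_twist_pStar_of_surj_of_ram`), hence
`ord₃ #Ш_an(V) + ord₃ #Ш_an(W) ≤ ord₃ #Ш(V) + ord₃ #Ш(W)` on X4 ∧ (G-ord, `e = 2`) ∧ `p = 3` ∧ ranks
`(0,0)` ∧ `surj(3) ∧ ram(3)`, from (⊇/K) and named facts. [cite: GreenbergLNM1716, Thm. 4.1 (p. 102)]
[cite: Kato2004Asterisque, Thm. 17.4 (p. 273)] -/
theorem XGordCyclotomicThreeLower.exists_padicVal_shaAn_add_le_of_surj_of_ram
    (hKato : Kato2004.charIdeal_dvd_padicLFunction_cyclotomicThree_of_surjective)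
    (hGr : Greenberg1999.thm41_charValue_rankZero_numberField)
    (hMilne : Milne1972.bsdQuotient_baseChange_quadratic_anyModel)
    (hGZK : rank_eq_analyticRank_of_analyticRank_le_one) (hmod : hasEntireLFunction_rat)
    (hmodD : nonempty_modularParametrizationData)
    (C : VariableChange ℚ) (hC : C • V.quadraticTwist (-(3 : ℚ)) = W)
    (hord : IsOrdinaryAt V 3) (hsurj : Surj W 3) (hram : Ram W 3)
    (hadd : Addv W 3) (hrV : V.analyticRank = 0) (hrW : W.analyticRank = 0) :
    ∃ qV qW : ℚ, shaAn V = (qV : ℂ) ∧ shaAn W = (qW : ℂ) ∧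
      padicValRat 3 qV + padicValRat 3 qW ≤ (padicValNat 3 V.shaOrder : ℤ) + padicValNat 3 W.shaOrder := by
  have hC' : C • V.quadraticTwist (((-((3 : ℕ) : ℤ)) : ℤ) : ℚ) = W := by push_cast; exact hC
  exact XGordCyclotomicThreeLower.exists_padicVal_shaAn_add_le_of_facts V W hLowK hKato hGr hMilne hGZK
    hmod hmodD C hC hord
    (forall_surj_pow_of_twist_pStar_of_surj_of_ram 3 V (k := -1) (by norm_num) (Or.inr rfl) C hC'
      hsurj hram) hadd hrV hrW

/-- **The two-sided main conjecture over `K` gives the EQUALITY of sums.** In the situation of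
`…_of_surj_of_ram`: the UPPER line V14b (`X4CyclotomicThree.exists_padicVal_shaOrder_add_le_of_surj_of_ram`,
Kato's divisibility ⊆ over `K`, a THEOREM modulo named facts) and the LOWER twin (⊇/K, the residual
input) together give **`ord₃ #Ш(V) + ord₃ #Ш(W) = ord₃ #Ш_an(V) + ord₃ #Ш_an(W)`**.
[cite: Kato2004Asterisque, Thm. 17.4 (3) (p. 273)] [cite: GreenbergLNM1716, Thm. 4.1 (p. 102)] -/
theorem XGordCyclotomicThreeLower.padicVal_shaOrder_add_eq_of_surj_of_ram
    (hKato : Kato2004.charIdeal_dvd_padicLFunction_cyclotomicThree_of_surjective)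
    (hGr : Greenberg1999.thm41_charValue_rankZero_numberField)
    (hMilne : Milne1972.bsdQuotient_baseChange_quadratic_anyModel)
    (hGZK : rank_eq_analyticRank_of_analyticRank_le_one) (hmod : hasEntireLFunction_rat)
    (hmodD : nonempty_modularParametrizationData)
    (C : VariableChange ℚ) (hC : C • V.quadraticTwist (-(3 : ℚ)) = W)
    (hord : IsOrdinaryAt V 3) (hsurj : Surj W 3) (hram : Ram W 3)
    (hadd : Addv W 3) (hrV : V.analyticRank = 0) (hrW : W.analyticRank = 0) :
    ∃ qV qW : ℚ, shaAn V = (qV : ℂ) ∧ shaAn W = (qW : ℂ) ∧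
      (padicValNat 3 V.shaOrder : ℤ) + padicValNat 3 W.shaOrder = padicValRat 3 qV + padicValRat 3 qW := by
  obtain ⟨qV, qW, hqV, hqW, hle⟩ := X4CyclotomicThree.exists_padicVal_shaOrder_add_le_of_surj_of_ram V W
    hKato hGr hMilne hGZK hmod hmodD C hC hord hsurj hram hadd hrV hrW
  obtain ⟨qV', qW', hqV', hqW', hge⟩ :=
    XGordCyclotomicThreeLower.exists_padicVal_shaAn_add_le_of_surj_of_ram V W hLowK hKato hGr hMilne
      hGZK hmod hmodD C hC hord hsurj hram hadd hrV hrW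
  have hqq : qV' = qV := by exact_mod_cast hqV'.symm.trans hqV
  have hqq' : qW' = qW := by exact_mod_cast hqW'.symm.trans hqW
  subst hqq hqq'
  exact ⟨qV', qW', hqV, hqW, le_antisymm hle hge⟩

/-- **`Typed.MissingLowerBoundAt W 3` for the ADDITIVE curve from (⊇/K) and the UPPER half of its
good ordinary TWIST** (X4 ∧ (G-ord, `e = 2`) ∧ `p = 3` ∧ ranks `(0,0)` ∧ `surj ∧ ram`, anomalous rows
included): `ord₃ q_V + ord₃ q_W ≤ ord₃ #Ш(V) + ord₃ #Ш(W)` and `ord₃ #Ш(V) ≤ ord₃ q_V` give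
`ord₃ q_W ≤ ord₃ #Ш(W)`. [cite: GreenbergLNM1716, Thm. 4.1 (p. 102)] [cite: Miller2011LMS, Def. 1.1] -/
theorem XGordCyclotomicThreeLower.missingLowerBoundAt_of_missingUpperBoundAt_twist_of_surj_of_ram
    (hKato : Kato2004.charIdeal_dvd_padicLFunction_cyclotomicThree_of_surjective)
    (hGr : Greenberg1999.thm41_charValue_rankZero_numberField)
    (hMilne : Milne1972.bsdQuotient_baseChange_quadratic_anyModel)
    (hGZK : rank_eq_analyticRank_of_analyticRank_le_one) (hmod : hasEntireLFunction_rat)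
    (hmodD : nonempty_modularParametrizationData)
    (C : VariableChange ℚ) (hC : C • V.quadraticTwist (-(3 : ℚ)) = W)
    (hord : IsOrdinaryAt V 3) (hsurj : Surj W 3) (hram : Ram W 3)
    (hadd : Addv W 3) (hrV : V.analyticRank = 0) (hrW : W.analyticRank = 0)
    (huV : MissingUpperBoundAt V 3) : MissingLowerBoundAt W 3 := by
  obtain ⟨qV, qW, hqV, hqW, hge⟩ :=
    XGordCyclotomicThreeLower.exists_padicVal_shaAn_add_le_of_surj_of_ram V W hLowK hKato hGr hMilne
      hGZK hmod hmodD C hC hord hsurj hram hadd hrV hrW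
  obtain ⟨qV', hqV', hu⟩ := huV
  have hqq : qV' = qV := by exact_mod_cast hqV'.symm.trans hqV
  subst hqq
  exact ⟨qW, hqW, by linarith⟩

/-- **Symmetrically: `Typed.MissingLowerBoundAt V 3` for the GOOD ORDINARY curve `V` from (⊇/K) and
the UPPER half of its additive twist `W`** (the latter is, on X4 ∧ (G-ord)@3 ∧ `surj`, the cell's
Kato-component chain, e.g. `ClassX4Gord.missingUpperBoundAt_three_of_katoComponent_of_surj`).
[cite: GreenbergLNM1716, Thm. 4.1 (p. 102)] [cite: Miller2011LMS, Def. 1.1] -/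
theorem XGordCyclotomicThreeLower.missingLowerBoundAt_twist_of_missingUpperBoundAt_of_surj_of_ram
    (hKato : Kato2004.charIdeal_dvd_padicLFunction_cyclotomicThree_of_surjective)
    (hGr : Greenberg1999.thm41_charValue_rankZero_numberField)
    (hMilne : Milne1972.bsdQuotient_baseChange_quadratic_anyModel)
    (hGZK : rank_eq_analyticRank_of_analyticRank_le_one) (hmod : hasEntireLFunction_rat)
    (hmodD : nonempty_modularParametrizationData)
    (C : VariableChange ℚ) (hC : C • V.quadraticTwist (-(3 : ℚ)) = W)
    (hord : IsOrdinaryAt V 3) (hsurj : Surj W 3) (hram : Ram W 3)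
    (hadd : Addv W 3) (hrV : V.analyticRank = 0) (hrW : W.analyticRank = 0)
    (huW : MissingUpperBoundAt W 3) : MissingLowerBoundAt V 3 := by
  obtain ⟨qV, qW, hqV, hqW, hge⟩ :=
    XGordCyclotomicThreeLower.exists_padicVal_shaAn_add_le_of_surj_of_ram V W hLowK hKato hGr hMilne
      hGZK hmod hmodD C hC hord hsurj hram hadd hrV hrW
  obtain ⟨qW', hqW', hu⟩ := huW
  have hqq : qW' = qW := by exact_mod_cast hqW'.symm.trans hqW
  subst hqq
  exact ⟨qV, hqV, by linarith⟩

/-- **Λ-adic twist transport at `3`: `BSD(W,3) ↔ BSD(V,3)` under the two-sided main conjecture over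
`K = ℚ(ζ₃)`** (X4 ∧ (G-ord, `e = 2`) ∧ `p = 3` ∧ ranks `(0,0)` ∧ `surj ∧ ram`): from the equality of sums
(`…padicVal_shaOrder_add_eq_of_surj_of_ram`) the BSD defects `ord₃ #Ш − ord₃ #Ш_an` of the additive
curve `W` and of its good ordinary twist `V` are opposite, so one vanishes iff the other does (Miller's
`BSD(E,3)` via `bsdp_of_missingPPartAt` / `missingPPartAt_of_bsdp`, GZK for the finiteness of `Ш`).
[cite: Kato2004Asterisque, Thm. 17.4 (3) (p. 273)] [cite: Miller2011LMS, §1 and Def. 1.1] -/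
theorem XGordCyclotomicThreeLower.bsdp_iff_bsdp_twist_of_surj_of_ram
    (hKato : Kato2004.charIdeal_dvd_padicLFunction_cyclotomicThree_of_surjective)
    (hGr : Greenberg1999.thm41_charValue_rankZero_numberField)
    (hMilne : Milne1972.bsdQuotient_baseChange_quadratic_anyModel)
    (hGZK : rank_eq_analyticRank_of_analyticRank_le_one) (hmod : hasEntireLFunction_rat)
    (hmodD : nonempty_modularParametrizationData)
    (C : VariableChange ℚ) (hC : C • V.quadraticTwist (-(3 : ℚ)) = W)
    (hord : IsOrdinaryAt V 3) (hsurj : Surj W 3) (hram : Ram W 3)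
    (hadd : Addv W 3) (hrV : V.analyticRank = 0) (hrW : W.analyticRank = 0) :
    BSDp W 3 ↔ BSDp V 3 := by
  obtain ⟨qV, qW, hqV, hqW, heq⟩ :=
    XGordCyclotomicThreeLower.padicVal_shaOrder_add_eq_of_surj_of_ram V W hLowK hKato hGr hMilne hGZK
      hmod hmodD C hC hord hsurj hram hadd hrV hrW
  have hrV1 : V.analyticRank ≤ 1 := by rw [hrV]; exact zero_le_one
  have hrW1 : W.analyticRank ≤ 1 := by rw [hrW]; exact zero_le_one
  haveI : Finite V.sha := (hGZK V hrV1).2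
  haveI : Finite W.sha := (hGZK W hrW1).2
  constructor
  · intro hW
    obtain ⟨qW', hqW', hvW⟩ := missingPPartAt_of_bsdp W 3 hW
    have hqq : qW' = qW := by exact_mod_cast hqW'.symm.trans hqW
    subst hqq
    exact bsdp_of_missingPPartAt V 3 hGZK hrV1 ⟨qV, hqV, by linarith⟩
  · intro hV
    obtain ⟨qV', hqV', hvV⟩ := missingPPartAt_of_bsdp V 3 hV
    have hqq : qV' = qV := by exact_mod_cast hqV'.symm.trans hqV
    subst hqq
    exact bsdp_of_missingPPartAt W 3 hGZK hrW1 ⟨qW, hqW, by linarith⟩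

/-- **`BSD(W,3)` (and `BSD(V,3)`) on X4 ∧ (G-ord, `e = 2`) ∧ `p = 3` ∧ ranks `(0,0)` ∧ `surj ∧ ram` —
ANOMALOUS ROWS INCLUDED — from (⊇/K) and named facts only.** `BSD(V,3)` for the good ordinary twist
with `ρ̄_{V,3}` onto (transported from `surj(3)` of `W`, `surj_iff_of_model_twist`) is the tree theorem
`bsdp_three_of_goodOrd_of_surj_noL20` (Yan–Zhu 2026 Thm. 4.15 [PUB\*, flag `YZ26@3-BF-ERL-Ohta`] `hYZ`,
modularity, GZK; Wuthrich's Lemma 20 a tree theorem); the twist transport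
`…bsdp_iff_bsdp_twist_of_surj_of_ram` carries it to the additive curve. No `ℓ ∣ 9` slack, no
`ExactLeadingTermAt`, no Tamagawa / `#Ш_an` unit bit. Label X4 UNCHANGED; nothing booked.
[cite: YanZhu2024MainConjNonCM, Thm. 4.15 (§4.6)] [cite: Kato2004Asterisque, Thm. 17.4 (3) (p. 273)]
[cite: GreenbergLNM1716, Thm. 4.1 (p. 102)] [cite: Milne1972ArithmeticAV, §1 Thm. 1] -/
theorem XGordCyclotomicThreeLower.bsdp_of_surj_of_ram
    (hYZ : YanZhu2026.thm415_padicValRat_bsd_rank_le_one)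
    (hKato : Kato2004.charIdeal_dvd_padicLFunction_cyclotomicThree_of_surjective)
    (hGr : Greenberg1999.thm41_charValue_rankZero_numberField)
    (hMilne : Milne1972.bsdQuotient_baseChange_quadratic_anyModel)
    (hGZK : rank_eq_analyticRank_of_analyticRank_le_one) (hmod : hasEntireLFunction_rat)
    (hmodD : nonempty_modularParametrizationData)
    (C : VariableChange ℚ) (hC : C • V.quadraticTwist (-(3 : ℚ)) = W)
    (hord : IsOrdinaryAt V 3) (hsurj : Surj W 3) (hram : Ram W 3)
    (hadd : Addv W 3) (hrV : V.analyticRank = 0) (hrW : W.analyticRank = 0) :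
    BSDp W 3 ∧ BSDp V 3 := by
  have hsurjV : Surj V 3 := (surj_iff_of_model_twist V 3 (by norm_num : (-(3 : ℚ)) ≠ 0) ⟨C, hC⟩).mp hsurj
  have hV : BSDp V 3 :=
    bsdp_three_of_goodOrd_of_surj_noL20 hYZ hmod hGZK (by rw [hrV]; exact zero_le_one) hord hsurjV
  exact ⟨(XGordCyclotomicThreeLower.bsdp_iff_bsdp_twist_of_surj_of_ram V W hLowK hKato hGr hMilne hGZK
    hmod hmodD C hC hord hsurj hram hadd hrV hrW).mpr hV, hV⟩

end Facts

/-! ## Class forms on N11's (G-ord)@3 rows (`ClassX4Gord W 3`; defect `e = 2` is automatic at `3`) -/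

section ClassForms

variable {W : WeierstrassCurve ℚ} [W.IsElliptic] [W.IsGloballyMinimal]

/- (⊇/K) for every good-ordinary twist model `V` of `W^{(−3)}` — the per-row residual input of the class
forms, shared by the theorems of this section. -/
variable
    (hLowK : ∀ (V : WeierstrassCurve ℚ) [V.IsElliptic] [V.IsGloballyMinimal] (C : VariableChange ℚ),
      GoodOrd V 3 → C • V.quadraticTwist (-(3 : ℚ)) = W →
      ∀ {κ : ZpExtension (CyclotomicField 3 ℚ) 3}
      {γ : Field.absoluteGaloisGroup (CyclotomicField 3 ℚ)} {N : ℕ} [NeZero N]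
      {f : CuspForm (Gamma0 N) 2},
      κ.IsCyclotomic → κ.IsTopGenerator γ →
      (∃ ζ : ℤ_[3]ˣ, IsOfFinOrder ζ ∧
        ((GaloisRep.cyclotomicCharacter (CyclotomicField 3 ℚ) 3 γ * ζ : ℤ_[3]ˣ) : ℤ_[3]) =
          (cyclotomicGenerator 3 : ℤ_[3])) →
      IsNewformOf V f →
      ∀ (D : (V.baseChange (CyclotomicField 3 ℚ)).SelmerDualData κ γ) (ϖ ϖ' : ℚ),
        (ϖ : ℝ) * V.realPeriodRat = plusPeriod f →
        (ϖ' : ℝ) * V.imaginaryPeriodRat = minusPeriod f →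
        ∀ g ∈ D.charIdeal, ∃ h : IwasawaAlgebra 3,
          iwasawaToPowerSeries 3 g =
            iwasawaToPowerSeries 3 h *
              (PowerSeries.C ((ϖ : ℚ_[3]) * (ϖ' : ℚ_[3])) *
                (padicLFunction f ((unitRoot V 3 : ℤ_[3]) : ℚ_[3]) *
                  padicLFunctionMinusBranch f ((unitRoot V 3 : ℤ_[3]) : ℚ_[3]) 1)))

include hLowK

/-- **X4♯(G-ord) at `3` ∧ `surj ∧ ram`, `r_an(E) = 0`, twist of analytic rank `0`, EVERY ROW (anomalous
included): the LOWER half `ord₃ #Ш_an(E) ≤ ord₃ #Ш(E)` ⟸ (⊇/K) for the good ordinary twist models of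
`E^{(−3)}` + the UPPER half of those twists** (per-row binders, quantified over all globally minimal
`V`, `C` with `GoodOrd V 3`, `C • V^{(−3)} = E`; such a model exists by
`ClassX4Gord.exists_goodOrd_pStar_twist_model`, `e = 2` by `semistabilityIndex_eq_two_of_typeG_three`).
Named facts: Kato (torsion over `K`), Greenberg, Milne; modularity, GZK. X4 / N11 labels unchanged.
[cite: GreenbergLNM1716, Thm. 4.1 (p. 102)] [cite: Miller2011LMS, Def. 1.1] -/
theorem ClassX4Gord.missingLowerBoundAt_three_rankZero_of_lowerK_of_surj_of_ram [Fact (Nat.Prime 3)]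
    (hKato : Kato2004.charIdeal_dvd_padicLFunction_cyclotomicThree_of_surjective)
    (hGr : Greenberg1999.thm41_charValue_rankZero_numberField)
    (hMilne : Milne1972.bsdQuotient_baseChange_quadratic_anyModel)
    (hGZK : rank_eq_analyticRank_of_analyticRank_le_one) (hmod : hasEntireLFunction_rat)
    (hmodD : nonempty_modularParametrizationData)
    (hX : ClassX4Gord W 3) (hsurj : Surj W 3) (hram : Ram W 3) (hr : W.analyticRank = 0)
    (hrV : ∀ (V : WeierstrassCurve ℚ) [V.IsElliptic] [V.IsGloballyMinimal] (C : VariableChange ℚ),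
      GoodOrd V 3 → C • V.quadraticTwist (-(3 : ℚ)) = W → V.analyticRank = 0)
    (huV : ∀ (V : WeierstrassCurve ℚ) [V.IsElliptic] [V.IsGloballyMinimal] (C : VariableChange ℚ),
      GoodOrd V 3 → C • V.quadraticTwist (-(3 : ℚ)) = W → MissingUpperBoundAt V 3) :
    MissingLowerBoundAt W 3 := by
  obtain ⟨V, iV, iVm, C, hgo, hC⟩ := ClassX4Gord.exists_goodOrd_pStar_twist_model W 3 hX
    (semistabilityIndex_eq_two_of_typeG_three W hX.typeGOrd.typeG hX.addv.2)
  have hC' : C • V.quadraticTwist (-(3 : ℚ)) = W := by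
    have h3 : ((-1 : ℚ) ^ ((3 : ℕ) / 2) * (3 : ℕ)) = -(3 : ℚ) := by norm_num
    rw [← h3]; exact hC
  exact XGordCyclotomicThreeLower.missingLowerBoundAt_of_missingUpperBoundAt_twist_of_surj_of_ram V W
    (fun hκ hγ hγ' hf D ϖ ϖ' hϖ hϖ' g hg ↦ hLowK V C hgo hC' hκ hγ hγ' hf D ϖ ϖ' hϖ hϖ' g hg)
    hKato hGr hMilne hGZK hmod hmodD C hC' hgo hsurj hram hX.addv.2 (hrV V C hgo hC') hr
    (huV V C hgo hC')

/-- **X4♯(G-ord) at `3` ∧ `surj ∧ ram`, `r_an(E) = 0`, twist of analytic rank `0`, EVERY ROW (anomalous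
included): `BSD(E,3)` ⟸ (⊇/K) for the good ordinary twist models of `E^{(−3)}`** and the named facts
Yan–Zhu 2026 Thm. 4.15 (`hYZ`, for the twist), Kato Thm. 17.4 (3) over `K` (`hKato`), Greenberg Thm. 4.1
(`hGr`), Milne (`hMilne`), modularity (`hmod`, `hmodD`), GZK (`hGZK`). The one non-fact input is (⊇/K)
= PLAN §1.2 II.3's wall at `p = 3`; X4♯(G-ord) stays CONSTRUCTION-SHAPED; nothing booked.
[cite: YanZhu2024MainConjNonCM, Thm. 4.15 (§4.6)] [cite: Kato2004Asterisque, Thm. 17.4 (3) (p. 273)]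
[cite: GreenbergLNM1716, Thm. 4.1 (p. 102)] [cite: Milne1972ArithmeticAV, §1 Thm. 1] -/
theorem ClassX4Gord.bsdp_three_rankZero_of_lowerK_of_surj_of_ram [Fact (Nat.Prime 3)]
    (hYZ : YanZhu2026.thm415_padicValRat_bsd_rank_le_one)
    (hKato : Kato2004.charIdeal_dvd_padicLFunction_cyclotomicThree_of_surjective)
    (hGr : Greenberg1999.thm41_charValue_rankZero_numberField)
    (hMilne : Milne1972.bsdQuotient_baseChange_quadratic_anyModel)
    (hGZK : rank_eq_analyticRank_of_analyticRank_le_one) (hmod : hasEntireLFunction_rat)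
    (hmodD : nonempty_modularParametrizationData)
    (hX : ClassX4Gord W 3) (hsurj : Surj W 3) (hram : Ram W 3) (hr : W.analyticRank = 0)
    (hrV : ∀ (V : WeierstrassCurve ℚ) [V.IsElliptic] [V.IsGloballyMinimal] (C : VariableChange ℚ),
      GoodOrd V 3 → C • V.quadraticTwist (-(3 : ℚ)) = W → V.analyticRank = 0) :
    BSDp W 3 := by
  obtain ⟨V, iV, iVm, C, hgo, hC⟩ := ClassX4Gord.exists_goodOrd_pStar_twist_model W 3 hX
    (semistabilityIndex_eq_two_of_typeG_three W hX.typeGOrd.typeG hX.addv.2)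
  have hC' : C • V.quadraticTwist (-(3 : ℚ)) = W := by
    have h3 : ((-1 : ℚ) ^ ((3 : ℕ) / 2) * (3 : ℕ)) = -(3 : ℚ) := by norm_num
    rw [← h3]; exact hC
  exact (XGordCyclotomicThreeLower.bsdp_of_surj_of_ram V W
    (fun hκ hγ hγ' hf D ϖ ϖ' hϖ hϖ' g hg ↦ hLowK V C hgo hC' hκ hγ hγ' hf D ϖ ϖ' hϖ hϖ' g hg)
    hYZ hKato hGr hMilne hGZK hmod hmodD C hC' hgo hsurj hram hX.addv.2 (hrV V C hgo hC') hr).1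

end ClassForms

end Summit.BirchSwinnertonDyer.Rank1Residual.Additive

end
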